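import Mathlib
import Summits.AnomalousDissipation.AnomalousDissipation.Theses.DyadicWallCascade
import Literature.Uncategorized.SteadyNSRealAnalytic
import Summits.AnomalousDissipation.AnomalousDissipation.Theorems.DyadicRealisation.Negative.WallProfileExistsFalseOfSteadyNSRealAnalytic

/-!
# No exact inner gluing at any single level of the dyadic ladder (modulo real-analyticity)
# — negative lemma for the crux `DyadicRealisation` of route `DyadicWallCascade`
# (rev-1 item stmt-AnomalousDissipation-18630, restated rev 2 as stmt-AnomalousDissipation-17918)

Refuter file, Negative lane (D-0016), `Summits/AnomalousDissipation`, sub-problem `AnomalousDissipation`.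

Context.  The crux `DyadicRealisation` is `⟨viscous wall profile block⟩ → CoherentStates.SteadyZerothLaw`:
ONE entire force-free steady Navier–Stokes profile `W` (at `ν = 1`), blowing down along `2^m` on the
band `1 ≤ X₂ ≤ 2` to a steady Euler hierarchy `V` with zero mass flux and NON-ZERO energy flux `F`
through the unit square of the plane `X₂ = 1`, is to be realised along `ν_m = 2^(-m)` by steady states
`u_m` on the unit torus that look like `W (x / ν_m)` near the wall.  The rev-1 profile object
`WallProfileExists` (exact unit horizontal periods on the slab `|X₂| ≤ 1`, period `2^j` on the dyadic
bands) is false modulo the classical theorem H = `Literature.Uncategorized.SteadyNSRealAnalytic`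
(smooth entire steady Navier–Stokes flows are real-analytic: Morrey 1958, Masuda 1967, Kahane 1969;
for bounded flows also Lemarié-Rieusset 2016 Thm 9.12) — `WallProfileExists_false_of_SteadyNSRealAnalytic`
in this directory — and the route was repaired (rev 2, 2026-08-17): the profile `ViscousWallProfile`
now carries NO periodicity clause and the box states are `2^m`-periodic approximants `U_m ≈ W`.

This file isolates the mechanism-level content of that refutation and sharpens it into the form the
repaired crux must respect.  The contradiction needs neither the unit period, nor the unit slab, nor
boundedness, mirror symmetry, pressure bounds or band periods of `W`, nor any Euler structure,
smoothness-up-to-the-wall or dilation invariance of `V`: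

`energyFlux_eq_zero_of_slabPeriodic_blowdown`: modulo H, if an entire smooth force-free steady
Navier–Stokes field `W` has two axis-parallel horizontal periods `a • e₀`, `b • e₁` (`a, b ≠ 0`) on
SOME slab `|X₂| ≤ δ` (`δ > 0`) and blows down along `2^m`, uniformly on the band, to a field `V`
differentiable on the open upper half-space, then the energy flux of `V` through the unit square of
`X₂ = 1` is carried by the mean mass flux alone: zero mass flux forces `F = 0` (for any `Q`).

Consequence (informal, for the planner and the provers of stmt-17918): if for even ONE level `m` a
steady state `u_m` on the UNIT torus coincides on a collar `|x₃| < η` of the wall with `W (x / ν_m)`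
for an entire steady Navier–Stokes profile `W` (periodic or not elsewhere), then `W` is
`(1/ν_m)`-periodic in `X₀, X₁` on the slab `|X₂| ≤ η/(2ν_m)`, and the lemma (`a = b = 1/ν_m`,
`δ = η/(2ν_m)`) gives `F = 0` for its blow-down: no level of the ladder can be glued EXACTLY onto a
profile whose blow-down carries flux.  Any proof of the repaired crux must keep `U_m ≠ W` on every
collar of the wall, at every level — the inner problem is genuinely `m`-dependent.

Proof: the identity principle propagates each slab period to all of `ℝ³` (the only use of H); the
tree lemmas `periodic_nat_mul`, `blowdown_periodic`, `const_on_line` of `DyadicWallCascadeNegative`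
then make `V` constant along both horizontal axes through every band point, so the trace
`q ↦ V (q₁, q₂, 1)` is constant; zero mass flux kills its vertical component and with it the
energy-flux integrand.  `WallProfileExists_false_of_SteadyNSRealAnalytic` is the case `a = b = δ = 1`.

## References

* [LemarieRieusset2016] P. G. Lemarié-Rieusset, *The Navier–Stokes Problem in the 21st Century*,
  CRC Press 2016, Thm 9.12 (book p. 240; PDF p. 260, read): bounded mild solutions on `(T₀,T₁) × ℝ³`
  are analytic in space and time; refs. [249] Kahane 1969, [350] Masuda 1967 there.
* [Morrey1958] C. B. Morrey, Amer. J. Math. 80 (1958) 198–218 (doi:10.2307/2372830).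
* [Kahane1969] C. Kahane, Arch. Rational Mech. Anal. 33 (1969) 386–405 (doi:10.1007/bf00247697).
-/
open scoped BigOperators Topology
open Filter Set MeasureTheory

namespace Summit.AnomalousDissipation.AnomalousDissipation.Theorems

-- the mandated namespace `Summit.<Summit>.<Problem>.Theorems` repeats `AnomalousDissipation` (single-problem summit)
set_option linter.dupNamespace false

namespace DyadicWallCascadeNegative

/-- Identity principle on a slab of arbitrary half-width `δ > 0`: an entire real-analytic field that
is `v`-periodic on `|X₂| ≤ δ` is `v`-periodic everywhere (generalises `periodic_of_analytic_of_slab`,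
which is the case `δ = 1`). [folklore] -/
theorem periodic_of_analytic_of_slab_width {W : EuclideanSpace ℝ (Fin 3) → EuclideanSpace ℝ (Fin 3)}
    (hW : AnalyticOnNhd ℝ W Set.univ) (v : EuclideanSpace ℝ (Fin 3)) {δ : ℝ} (hδ : 0 < δ)
    (hv : ∀ X : EuclideanSpace ℝ (Fin 3), |X 2| ≤ δ → W (X + v) = W X) :
    ∀ X, W (X + v) = W X := by
  have hin : ∀ X : EuclideanSpace ℝ (Fin 3),
      AnalyticAt ℝ (fun Y : EuclideanSpace ℝ (Fin 3) => Y + v) X := fun X =>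
    analyticAt_id.add analyticAt_const
  have h1 : AnalyticOnNhd ℝ (fun X => W (X + v)) Set.univ := fun X _ =>
    (hW (X + v) trivial).comp (f := fun Y : EuclideanSpace ℝ (Fin 3) => Y + v) (hin X)
  have h2 : (fun X => W (X + v)) =ᶠ[𝓝 (0 : EuclideanSpace ℝ (Fin 3))] W := by
    have hopen : IsOpen {X : EuclideanSpace ℝ (Fin 3) | |X 2| < δ} := by
      have hc : Continuous fun X : EuclideanSpace ℝ (Fin 3) => |X 2| :=
        (continuous_abs.comp (PiLp.continuous_apply 2 (fun _ : Fin 3 => ℝ) (2 : Fin 3)))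
      exact isOpen_lt hc continuous_const
    have hmem : (0 : EuclideanSpace ℝ (Fin 3)) ∈ {X : EuclideanSpace ℝ (Fin 3) | |X 2| < δ} := by
      simpa using hδ
    filter_upwards [hopen.mem_nhds hmem] with X hX
    exact hv X (le_of_lt hX)
  have h3 := AnalyticOnNhd.eq_of_eventuallyEq h1 hW h2
  intro X
  exact congrFun h3 X

end DyadicWallCascadeNegative

open DyadicWallCascadeNegative in
/-- **No exact inner gluing, modulo H.**  Assume H (`SteadyNSRealAnalytic`).  Let `(W, P)` be a
`C^∞` solution on all of `ℝ³` of the stationary force-free Navier–Stokes system at unit viscosity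
(clauses verbatim as in `DyadicWallCascade.WallProfileExists`), let `W` have the horizontal periods
`a • e₀` and `b • e₁` (`a ≠ 0`, `b ≠ 0`) on some slab `|X₂| ≤ δ` with `δ > 0`, and let the dyadic
blow-downs `W (2^m • X)` converge uniformly on the band `1 ≤ X₂ ≤ 2` to a field `V` that is
differentiable on the open upper half-space.  If the mass flux `∫_{[0,1]²} V₂(q,1) dq` vanishes, then
so does the energy flux: `∫_{[0,1]²} V₂ (|V|²/2 + Q)(q,1) dq = F` forces `F = 0` (for ANY `Q`).
In particular no level `u_m = W(·/ν_m)` (near the wall, on the unit torus) of the dyadic ladder can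
be glued exactly onto one entire profile with a flux-carrying blow-down (route `DyadicWallCascade`,
crux `DyadicRealisation`, stmt-18630 rev 1 / stmt-17918 rev 2); and
`WallProfileExists_false_of_SteadyNSRealAnalytic` is the case `a = b = δ = 1`. [folklore] -/
theorem energyFlux_eq_zero_of_slabPeriodic_blowdown
    (hA : Literature.Uncategorized.SteadyNSRealAnalytic)
    {W V : EuclideanSpace ℝ (Fin 3) → EuclideanSpace ℝ (Fin 3)}
    {P Q : EuclideanSpace ℝ (Fin 3) → ℝ} {a b δ F : ℝ} (ha : a ≠ 0) (hb : b ≠ 0) (hδ : 0 < δ)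
    (hWs : ContDiff ℝ ((⊤ : ℕ∞) : WithTop ℕ∞) W) (hPs : ContDiff ℝ ((⊤ : ℕ∞) : WithTop ℕ∞) P)
    (hWdiv : ∀ X, ∑ i : Fin 3, (fderiv ℝ W X (EuclideanSpace.single i (1 : ℝ))) i = 0)
    (hNS : ∀ X, (fderiv ℝ W X) (W X) + gradient P X =
      ∑ i : Fin 3, fderiv ℝ (fun Y => fderiv ℝ W Y (EuclideanSpace.single i (1 : ℝ))) X
        (EuclideanSpace.single i (1 : ℝ)))
    (hWa : ∀ X : EuclideanSpace ℝ (Fin 3), |X 2| ≤ δ →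
      W (X + a • EuclideanSpace.single (0 : Fin 3) (1 : ℝ)) = W X)
    (hWb : ∀ X : EuclideanSpace ℝ (Fin 3), |X 2| ≤ δ →
      W (X + b • EuclideanSpace.single (1 : Fin 3) (1 : ℝ)) = W X)
    (hbd : ∀ ε : ℝ, 0 < ε → ∃ M : ℕ, ∀ m : ℕ, M ≤ m → ∀ X : EuclideanSpace ℝ (Fin 3),
      1 ≤ X 2 → X 2 ≤ 2 → ‖W ((2 : ℝ) ^ m • X) - V X‖ ≤ ε)
    (hVd : ∀ X : EuclideanSpace ℝ (Fin 3), 0 < X 2 → DifferentiableAt ℝ V X)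
    (hmass : ∫ q in Set.Icc (0 : ℝ) 1 ×ˢ Set.Icc (0 : ℝ) 1, (V !₂[q.1, q.2, (1 : ℝ)]) 2 = 0)
    (hflux : ∫ q in Set.Icc (0 : ℝ) 1 ×ˢ Set.Icc (0 : ℝ) 1,
      (V !₂[q.1, q.2, (1 : ℝ)]) 2 * (‖V !₂[q.1, q.2, (1 : ℝ)]‖ ^ 2 / 2 + Q !₂[q.1, q.2, (1 : ℝ)])
        = F) :
    F = 0 := by
  have hWan : AnalyticOnNhd ℝ W Set.univ := hA W P hWs hPs hWdiv hNS
  set v0 : EuclideanSpace ℝ (Fin 3) := a • EuclideanSpace.single (0 : Fin 3) (1 : ℝ) with hv0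
  set v1 : EuclideanSpace ℝ (Fin 3) := b • EuclideanSpace.single (1 : Fin 3) (1 : ℝ) with hv1
  have hP0 : ∀ X, W (X + v0) = W X := periodic_of_analytic_of_slab_width hWan _ hδ hWa
  have hP1 : ∀ X, W (X + v1) = W X := periodic_of_analytic_of_slab_width hWan _ hδ hWb
  have he0 : v0 2 = 0 := by simp [hv0]
  have he1 : v1 2 = 0 := by simp [hv1]
  have hpt2 : ∀ p q : ℝ, (!₂[p, q, (1 : ℝ)]) 2 = 1 := by intro p q; simp
  have hline0 : ∀ p q : ℝ,
      !₂[p, q, (1 : ℝ)] = !₂[(0 : ℝ), q, (1 : ℝ)] + (p / a) • v0 := by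
    intro p q; ext i; fin_cases i <;> simp [hv0]; field_simp
  have hline1 : ∀ q : ℝ,
      !₂[(0 : ℝ), q, (1 : ℝ)] = !₂[(0 : ℝ), (0 : ℝ), (1 : ℝ)] + (q / b) • v1 := by
    intro q; ext i; fin_cases i <;> simp [hv1]; field_simp
  have hconst : ∀ q : ℝ × ℝ, V !₂[q.1, q.2, (1 : ℝ)] = V !₂[(0 : ℝ), (0 : ℝ), (1 : ℝ)] := by
    intro q
    rw [hline0 q.1 q.2, const_on_line he0 (periodic_nat_mul _ hP0) hbd hVd _
      (by rw [hpt2]) (by rw [hpt2]; norm_num), hline1 q.2,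
      const_on_line he1 (periodic_nat_mul _ hP1) hbd hVd _ (by rw [hpt2]) (by rw [hpt2]; norm_num)]
  simp_rw [hconst] at hmass hflux
  have hvol : (volume : Measure (ℝ × ℝ)).real (Set.Icc (0 : ℝ) 1 ×ˢ Set.Icc (0 : ℝ) 1) = 1 := by
    simp only [Measure.real]
    rw [Measure.volume_eq_prod, Measure.prod_prod, Real.volume_Icc]
    simp
  rw [setIntegral_const, hvol, one_smul] at hmass
  rw [hmass] at hflux
  simp at hflux
  exact hflux.symm

end Summit.AnomalousDissipation.AnomalousDissipation.Theorems
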